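import Literature.MathematicalPhysics.QuantumFieldTheory.Balaban1983to89.B8Eq184Proof
import Literature.MathematicalPhysics.QuantumFieldTheory.Balaban1983to89.B7Eq32ExpDifferential

/-!
# `Balaban1983to89.B8Ineq1109Local` — T. Bałaban, *Spaces of regular gauge field configurations on a lattice and gauge fixing
# conditions*, Commun. Math. Phys. **99** (1985) 75–102 [Balaban1985RegularSpaces] ("B8"), proof of Theorem 4, p. 95 after (1.112): «thus
# `u′` is a solution of the problem described in Proposition 5 … the assumptions of this proposition are satisfied and we have the uniqueness
# property» — the TACIT ESTIMATE that `λ′ = (1/i) log u′` lies in the uniqueness domain (1.109) `|λ′|, |Dλ′|₍₋₁₎ < c₃`: pointwise at a bond,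
# from `U₁^{u′⁻¹} = U₂`, the representation (1.84) and the bounds (1.62) on `A₁, A₂` (concrete `ℤᵈ` carriers, general background)

statement-level skeleton of published theorems with citation tags; proofs where landed; nothing here is a claim about the
Yang–Mills mass gap

PDF held: `paper:balaban1985-cmp99-regular-spaces-gauge-fixing` (journal page = PDF page + 74); p. 95 [PDF 21] on the text layer (this seat,
2026-08-26); (1.84)–(1.85) p. 90 as proved on the lattice in `B8Eq184Proof`; [3] = [Balaban1985Averaging] (33)–(34), (40)–(41) p. 23 for
`g(i ad)` (`B7Eq32ExpDifferential.G40_eq`, `Literature.Analysis.Calculus.ExpDifferential.norm_gSer_sub_one_le`).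

WHAT IS PRINTED (p. 95, verbatim): "To prove the uniqueness let us assume that there are two transformations `u₁, u₂` satisfying the conditions
of the Theorem 4. Then we have two configurations `U₁ = U′^{u₁⁻¹}`, `U₂ = U′^{u₂⁻¹}`, `U₁ = e^{iηA₁}`, `U₂ = e^{iηA₂}`. They satisfy all the
conditions of the theorem, hence `A₂` satisfies (1.37), (1.38), and both configurations `A₁, A₂` satisfy the bounds (1.62). … We have `u′u₁ = u₂`,
hence `\overline{R₀u′u₁} = 1` on `Λ_j`, `j = 0, 1, …, k`, `U₁^{u′⁻¹} = U₂`, (1.112) thus `u′` is a solution of the problem described in Proposition 5.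
For `α₀ + α₁` sufficiently small the assumptions of this proposition are satisfied and we have the uniqueness property."  Proposition 5's
uniqueness clause (1.109): "Such a configuration `u′` is unique in the domain `|λ|, |Dλ|₍₋₁₎ < c₃`" (`u′ = e^{iλ}`; `|Dλ|₍₋₁₎ = sup_j sup_{Ω_j}
(Lʲη)|Dλ|`).  The estimate putting `λ′ = (1/i) log u′` in this domain is NOT displayed; it follows from `U₁^{u′⁻¹} = U₂` read through (1.84):
`A₂(b) = R(u′⁻¹(b₋))A₁(b) + g(i ad_{λ′(b₋)})(Dλ′)(b) + η𝔉₁ + η𝔉₂`, the invertibility of `g(i ad_Y)` for small `Y` ([3] (33)–(34)), and (1.62)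
`|A₁|, |A₂| < c(Lʲη)⁻¹` on `Ω_j` (`c = O(B₁(α₀ + α₁))`): `|Dλ′(b)| ≤ 5c(Lʲη)⁻¹`; `|λ′| ≤ 2|u′ − 1|` from (1.73) at the fine level ((1.112)).

WHAT THIS FILE PROVES (kernel, 0 sorry, theorems only, no `def`; conventions of `B8Eq184Proof`: `U_i = e^{iηA_i}` = `cfgExp η A_i`, `u′ = e^{iλ′}` =
`gaugeExp λ′`, `U₁^{u′⁻¹}` = `mgauge U₀ (u′)⁻¹ U₁`, `(Dλ′)(b) = B8Ineq132.covDerivFwd`, print's `i` kept).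
* §1 `norm_gAd_sub_self_le` — `|g(i ad_Y)X − X| ≤ ⅓|X|` for `|Y| ≤ 1/12` (`g(T) = 1 + O(T)`, [3] (34): `norm_gSer_sub_one_le`; the rotation
  `R(e^{−iY})` costs `2(e^{1/12} − 1)e^{1/12}`); `norm_le_of_gAd` — hence `|X| ≤ (3/2)|g(i ad_Y)X|`.
* §2 `norm_eta_covDerivFwd_le` — the a-priori bound `η|(Dλ′)(b)| ≤ |λ′(b₊)| + |λ′(b₋)|` for `U₀(b)` in the unit ball `U1`.
* §3 **`ineq1109_pointwise`** — at a bond `b = ⟨x, x + e_μ⟩`: if `U₁^{u′⁻¹}(b) = U₂(b)`, `|λ′(b±)| ≤ s ≤ 1/1000`, `|A₁(b)|, |A₂(b)| ≤ a` with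
  `ηa ≤ 1/170`, then `|(Dλ′)(b)| ≤ 5a`; **`ineq1109_scaled`** — with (1.62)'s `a = c(Lʲη)⁻¹`: `|(Dλ′)(b)| ≤ 5c·(Lʲη)⁻¹`, i.e. `(Lʲη)|Dλ′(b)| ≤ 5c`
  (the `|·|₍₋₁₎`-form of (1.109) on `Ω_j`).
* §5 `mgauge_quotient_eq` — «`U₁^{u′⁻¹} = U₂`» from `U′ = U₁^{u₁} = U₂^{u₂}`: the quotient is `u′ = u₁⁻¹u₂` in the tree's convention of the action (55).
* §4 `lam_of_unit` (+ `norm_quotient_sub_one_le`: `|u₁⁻¹u₂ − 1| ≤ |u₁ − 1| + |u₂ − 1|`) — the dictionary from (1.72)/(1.73) at the fine level to `λ′`: for a unit `u′(x)` with `|u′(x) − 1| ≤ ½`, `λ′(x) := (1/i) log u′(x)`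
  has `e^{iλ′(x)} = u′(x)` and `|λ′(x)| ≤ 2|u′(x) − 1|`.

READINGS / DECLARED DEVIATIONS: `ℤᵈ` carriers; `𝔸` any complete normed `ℂ`-algebra with `‖1‖ = 1`, `U₀` in the unit ball `U1` (print: unitary);
explicit sufficient constants (`5`, `⅓`, thresholds `1/1000`, `1/170`); the identity `U₁^{u′⁻¹} = U₂` is taken bondwise as a hypothesis (print's
(1.112), from `U′ = U_i^{u_i}`); (1.84) with the `η𝔉₁` term kept (G-B8-02).  NOT CLAIMED: Proposition 5's uniqueness clause itself, the value of
`c₃`, anything of Theorem 4.  Unit `pub-ymgap-dag-n04-b` (YM Track A, node N05 [B8]), 2026-08-26.  Tree API by name only, nothing restated.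
-/

noncomputable section

open NormedSpace
open Complex (I I_ne_zero)

namespace Literature.MathematicalPhysics.QuantumFieldTheory.Balaban1983to89.B8Ineq1109Local

open MatrixLog B7Prop1Explicit B7Eq92Concrete
open B7Eq78Linearization (conjR conjR_apply conjR_sub)
open B8Ineq132 (covDerivFwd)
open B8Eq182Proof (gAd frakF1 frakF2 norm_frakF1_le norm_frakF2_le)
open B8Eq184Proof (gaugeExp cfgExp eq184)
open B7Eq38Remainder (G40)
open B7Eq32ExpDifferential (G40_eq)
open Literature.Analysis.Calculus.ExpDifferential (ad gSer norm_ad_le norm_gSer_sub_one_le)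

-- `Site` alone could resolve to the torus sites of `Setup.lean`; re-export the `ℤ^d` sites of `B7Prop1Explicit`.
export B7Prop1Explicit (Site)

variable {d : ℕ}
variable {𝔸 : Type*} [NormedRing 𝔸] [NormedAlgebra ℂ 𝔸] [NormOneClass 𝔸] [CompleteSpace 𝔸]

/-! ## §1 `g(i ad_Y)` is close to the identity; a lower bound -/

/-- `‖e^{a}‖ ≤ e^{‖a‖}` (from the tree's `‖e^{a} − 1‖ ≤ e^{‖a‖} − 1`). [folklore] -/
private theorem norm_exp_le_rexp (a : 𝔸) : ‖exp a‖ ≤ Real.exp ‖a‖ := by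
  have h := Literature.Analysis.Calculus.norm_exp_sub_one_le a
  calc ‖exp a‖ = ‖(exp a - 1) + 1‖ := by rw [sub_add_cancel]
    _ ≤ ‖exp a - 1‖ + ‖(1 : 𝔸)‖ := norm_add_le _ _
    _ ≤ (Real.exp ‖a‖ - 1) + 1 := by rw [norm_one]; linarith
    _ = Real.exp ‖a‖ := by ring

omit [NormOneClass 𝔸] [CompleteSpace 𝔸] [NormedAlgebra ℂ 𝔸] [NormedRing 𝔸] in
/-- `e^{1/12} ≤ 1 + 1/12 + 1/144` and `e^{1/6} ≤ 6/5` (Mathlib's `Real.abs_exp_sub_one_sub_id_le`). [folklore] -/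
private theorem exp_small_bounds : Real.exp (1 / 12) ≤ 1 + 1 / 12 + 1 / 144 ∧ Real.exp (1 / 6) ≤ 6 / 5 := by
  have h1 := Real.abs_exp_sub_one_sub_id_le (x := 1 / 12) (by norm_num)
  have h2 := Real.abs_exp_sub_one_sub_id_le (x := 1 / 6) (by norm_num)
  rw [abs_le] at h1 h2
  constructor
  · nlinarith [h1.2]
  · nlinarith [h2.2]

/-- **`|g(i ad_Y)X − X| ≤ ⅓|X|` for `|Y| ≤ 1/12`** (print's `g(i ad_{λ(b₋)})` with `λ` small is a perturbation of the identity): `G40 X Y = g(T)X` with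
`T = −i ad_Y`, `‖T‖ ≤ 2‖Y‖ ≤ 1/6` (`B7Eq32ExpDifferential.G40_eq`), `‖g(T) − 1‖ ≤ (e^{1/6} − 1)/2 ≤ 1/10` ([3] (34), `norm_gSer_sub_one_le`), and the
rotation by `e^{−iY}` moves `X` by at most `2(e^{1/12} − 1)e^{1/12}‖X‖`. [cite: Balaban1985RegularSpaces, (1.84) p.90; Balaban1985Averaging, (33)–(34) p.23, (40)–(41) p.23] -/
theorem norm_gAd_sub_self_le (X : 𝔸) {Y : 𝔸} (hY : ‖Y‖ ≤ 1 / 12) : ‖gAd X Y - X‖ ≤ 1 / 3 * ‖X‖ := by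
  obtain ⟨e12, e6⟩ := exp_small_bounds
  have hXn := norm_nonneg X
  -- the linear term `G40 X Y = g(T) X`, `‖g(T) − 1‖ ≤ 1/10`
  set T : 𝔸 →L[ℂ] 𝔸 := -(I • ad ℂ Y) with hT
  have hTn : ‖T‖ ≤ 1 / 6 := by
    rw [hT, norm_neg, norm_smul, Complex.norm_I, one_mul]
    exact (norm_ad_le (𝕂 := ℂ) Y).trans (by linarith)
  have hg : ‖gSer ℂ T - 1‖ ≤ 1 / 10 := by
    have h := norm_gSer_sub_one_le (𝕂 := ℂ) T
    have hexp : Real.exp ‖T‖ ≤ 6 / 5 := (Real.exp_le_exp.mpr hTn).trans e6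
    linarith
  have hG : ‖G40 X Y - X‖ ≤ 1 / 10 * ‖X‖ := by
    rw [G40_eq X hY]
    have : gSer ℂ T X - X = (gSer ℂ T - 1) X := by simp
    rw [this]
    exact ((gSer ℂ T - 1).le_opNorm X).trans (mul_le_mul_of_nonneg_right hg hXn)
  -- the rotation `R(e^{−iY})`
  have hZ : ‖(-(I • Y) : 𝔸)‖ ≤ 1 / 12 := by rwa [norm_neg, norm_smul, Complex.norm_I, one_mul]
  have hZ' : ‖(I • Y : 𝔸)‖ ≤ 1 / 12 := by rwa [norm_smul, Complex.norm_I, one_mul]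
  have hE1 : ‖exp (-(I • Y) : 𝔸)‖ ≤ Real.exp (1 / 12) := (norm_exp_le_rexp _).trans (Real.exp_le_exp.mpr hZ)
  have hE2 : ‖exp (I • Y : 𝔸)‖ ≤ Real.exp (1 / 12) := (norm_exp_le_rexp _).trans (Real.exp_le_exp.mpr hZ')
  have hE3 : ‖exp (-(I • Y) : 𝔸) - 1‖ ≤ Real.exp (1 / 12) - 1 :=
    (Literature.Analysis.Calculus.norm_exp_sub_one_le _).trans (by linarith [Real.exp_le_exp.mpr hZ])
  have hE4 : ‖exp (I • Y : 𝔸) - 1‖ ≤ Real.exp (1 / 12) - 1 :=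
    (Literature.Analysis.Calculus.norm_exp_sub_one_le _).trans (by linarith [Real.exp_le_exp.mpr hZ'])
  -- `gAd X Y − X = R(w)(G40 − X) + (R(w)X − X)`, `w = e^{−iY}`
  have hsplit : gAd X Y - X = conjR (expUnit (-(I • Y))) (G40 X Y - X) + (conjR (expUnit (-(I • Y))) X - X) := by
    rw [gAd, conjR_sub]; abel
  have hc1 : ‖conjR (expUnit (-(I • Y))) (G40 X Y - X)‖ ≤ Real.exp (1 / 12) * (1 / 10 * ‖X‖) * Real.exp (1 / 12) := by
    rw [conjR_apply, val_inv_expUnit, val_expUnit, val_expUnit, neg_neg]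
    calc ‖exp (-(I • Y)) * (G40 X Y - X) * exp (I • Y)‖ ≤ ‖exp (-(I • Y) : 𝔸)‖ * ‖G40 X Y - X‖ * ‖exp (I • Y : 𝔸)‖ :=
          (norm_mul_le _ _).trans (mul_le_mul_of_nonneg_right (norm_mul_le _ _) (norm_nonneg _))
      _ ≤ Real.exp (1 / 12) * (1 / 10 * ‖X‖) * Real.exp (1 / 12) := by gcongr
  -- `R(w)X − X = (w − 1)X w⁻¹ + X(w⁻¹ − 1)`
  have hc2 : ‖conjR (expUnit (-(I • Y))) X - X‖ ≤ (Real.exp (1 / 12) - 1) * ‖X‖ * Real.exp (1 / 12) + ‖X‖ * (Real.exp (1 / 12) - 1) := by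
    rw [conjR_apply, val_inv_expUnit, val_expUnit, val_expUnit, neg_neg]
    have hid : exp (-(I • Y)) * X * exp (I • Y) - X = (exp (-(I • Y)) - 1) * X * exp (I • Y) + X * (exp (I • Y) - 1) := by
      noncomm_ring
    rw [hid]
    calc ‖(exp (-(I • Y)) - 1) * X * exp (I • Y) + X * (exp (I • Y) - 1)‖
        ≤ ‖(exp (-(I • Y)) - 1) * X * exp (I • Y)‖ + ‖X * (exp (I • Y) - 1)‖ := norm_add_le _ _
      _ ≤ ‖exp (-(I • Y) : 𝔸) - 1‖ * ‖X‖ * ‖exp (I • Y : 𝔸)‖ + ‖X‖ * ‖exp (I • Y : 𝔸) - 1‖ := by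
          gcongr
          · exact (norm_mul_le _ _).trans (mul_le_mul_of_nonneg_right (norm_mul_le _ _) (norm_nonneg _))
          · exact norm_mul_le _ _
      _ ≤ (Real.exp (1 / 12) - 1) * ‖X‖ * Real.exp (1 / 12) + ‖X‖ * (Real.exp (1 / 12) - 1) := by
          have h0 : 0 ≤ Real.exp (1 / 12) - 1 := by linarith [Real.add_one_le_exp (1 / 12 : ℝ)]
          gcongr
  rw [hsplit]
  refine (norm_add_le _ _).trans ((add_le_add hc1 hc2).trans ?_)
  set E : ℝ := Real.exp (1 / 12) with hEdef
  have hE1 : 1 ≤ E := by have := Real.add_one_le_exp (1 / 12 : ℝ); linarith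
  have hcoef : E * (1 / 10) * E + ((E - 1) * E + (E - 1)) ≤ 1 / 3 := by nlinarith
  calc E * (1 / 10 * ‖X‖) * E + ((E - 1) * ‖X‖ * E + ‖X‖ * (E - 1))
      = (E * (1 / 10) * E + ((E - 1) * E + (E - 1))) * ‖X‖ := by ring
    _ ≤ 1 / 3 * ‖X‖ := mul_le_mul_of_nonneg_right hcoef hXn

/-- **A lower bound for `g(i ad_Y)`**: `|X| ≤ (3/2)|g(i ad_Y)X|` for `|Y| ≤ 1/12` (from `norm_gAd_sub_self_le`). [cite: Balaban1985Averaging, (33)–(34) p.23] -/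
theorem norm_le_of_gAd (X : 𝔸) {Y : 𝔸} (hY : ‖Y‖ ≤ 1 / 12) : ‖X‖ ≤ 3 / 2 * ‖gAd X Y‖ := by
  have h := norm_gAd_sub_self_le X hY
  have h2 : ‖X‖ ≤ ‖gAd X Y‖ + ‖gAd X Y - X‖ := by
    calc ‖X‖ = ‖gAd X Y - (gAd X Y - X)‖ := by rw [sub_sub_cancel]
      _ ≤ ‖gAd X Y‖ + ‖gAd X Y - X‖ := norm_sub_le _ _
  linarith

/-! ## §2 The a-priori bound on `η(Dλ′)(b)` -/

omit [CompleteSpace 𝔸] in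
/-- `η(Dλ′)(b) = R(U₀(b))λ′(b₊) − λ′(b₋)`, so `η|(Dλ′)(b)| ≤ |λ′(b₊)| + |λ′(b₋)|` when `U₀(b)` lies in the unit ball `U1` (print: unitary).
[cite: Balaban1985RegularSpaces, (1.1) p.76, (1.81) p.90] -/
theorem norm_eta_covDerivFwd_le {η : ℝ} (hη : 0 < η) {U₀ : Site d → Fin d → 𝔸ˣ} {x : Site d} {μ : Fin d} (hU : U₀ x μ ∈ U1 𝔸)
    (lam : Site d → 𝔸) : η * ‖covDerivFwd η U₀ μ lam x‖ ≤ ‖lam (x + e μ)‖ + ‖lam x‖ := by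
  have hη' : ‖(η : ℝ)‖ = η := by rw [Real.norm_eq_abs, abs_of_pos hη]
  have h1 : η * ‖covDerivFwd η U₀ μ lam x‖ = ‖conjR (U₀ x μ) (lam (x + e μ)) - lam x‖ := by
    rw [covDerivFwd, norm_smul, norm_inv, hη', ← mul_assoc, mul_inv_cancel₀ hη.ne', one_mul]
  rw [h1]
  obtain ⟨hu, hu'⟩ := mem_U1.mp hU
  refine (norm_sub_le _ _).trans (add_le_add ?_ le_rfl)
  rw [conjR_apply]
  calc ‖(U₀ x μ : 𝔸) * lam (x + e μ) * ((U₀ x μ)⁻¹ : 𝔸ˣ)‖ ≤ ‖((U₀ x μ : 𝔸ˣ) : 𝔸)‖ * ‖lam (x + e μ)‖ * ‖(((U₀ x μ)⁻¹ : 𝔸ˣ) : 𝔸)‖ :=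
        (norm_mul_le _ _).trans (mul_le_mul_of_nonneg_right (norm_mul_le _ _) (norm_nonneg _))
    _ ≤ 1 * ‖lam (x + e μ)‖ * 1 := by gcongr
    _ = ‖lam (x + e μ)‖ := by ring

/-! ## §3 `|(Dλ′)(b)| ≤ 5|A|` from `U₁^{u′⁻¹} = U₂` -/

/-- The non-unitary cost of `R(u′⁻¹(b₋))`: `|R(e^{−iλ′})V| ≤ (6/5)|V|` for `|λ′(b₋)| ≤ 1/12`. [folklore] -/
private theorem norm_conjR_gaugeExp_inv_le {lam : Site d → 𝔸} {x : Site d} (hl : ‖lam x‖ ≤ 1 / 12) (V : 𝔸) :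
    ‖conjR (gaugeExp lam x)⁻¹ V‖ ≤ 6 / 5 * ‖V‖ := by
  obtain ⟨e12, -⟩ := exp_small_bounds
  have hZ : ‖(-(I • lam x) : 𝔸)‖ ≤ 1 / 12 := by rwa [norm_neg, norm_smul, Complex.norm_I, one_mul]
  have hZ' : ‖(I • lam x : 𝔸)‖ ≤ 1 / 12 := by rwa [norm_smul, Complex.norm_I, one_mul]
  rw [gaugeExp, val_inv_expUnit, conjR_apply, val_inv_expUnit, val_expUnit, val_expUnit, neg_neg]
  have h1 : ‖exp (-(I • lam x) : 𝔸)‖ ≤ Real.exp (1 / 12) := (norm_exp_le_rexp _).trans (Real.exp_le_exp.mpr hZ)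
  have h2 : ‖exp (I • lam x : 𝔸)‖ ≤ Real.exp (1 / 12) := (norm_exp_le_rexp _).trans (Real.exp_le_exp.mpr hZ')
  calc ‖exp (-(I • lam x)) * V * exp (I • lam x)‖ ≤ ‖exp (-(I • lam x) : 𝔸)‖ * ‖V‖ * ‖exp (I • lam x : 𝔸)‖ :=
        (norm_mul_le _ _).trans (mul_le_mul_of_nonneg_right (norm_mul_le _ _) (norm_nonneg _))
    _ ≤ Real.exp (1 / 12) * ‖V‖ * Real.exp (1 / 12) := by gcongr
    _ = (Real.exp (1 / 12) * Real.exp (1 / 12)) * ‖V‖ := by ring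
    _ ≤ 6 / 5 * ‖V‖ := by
        refine mul_le_mul_of_nonneg_right ?_ (norm_nonneg V)
        have hE1 : 1 ≤ Real.exp (1 / 12) := by have := Real.add_one_le_exp (1 / 12 : ℝ); linarith
        nlinarith

/-- **THE TACIT ESTIMATE OF p. 95: `u′ = u₂u₁⁻¹` LIES IN THE UNIQUENESS DOMAIN (1.109), bondwise.**  At a bond `b = ⟨x, x + e_μ⟩` let
`U₁^{u′⁻¹}(b) = U₂(b)` (print's (1.112)), `u′ = e^{iλ′}` with `|λ′(x)|, |λ′(x + e_μ)| ≤ s ≤ 1/1000` ((1.73) at the fine level with the worse constant,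
(1.112)), `U_i = e^{iηA_i}` with `|A₁(b)|, |A₂(b)| ≤ a` and `ηa ≤ 1/170` ((1.62) on `Ω_j`: `a = c(Lʲη)⁻¹`, `ηa = cL^{−j}` small), `U₀(b) ∈ U1`, `η > 0`.
Then `|(Dλ′)(b)| ≤ 5a`.  Proof: (1.84) (`B8Eq184Proof.eq184`) reads `A₂(b) = R(u′⁻¹(b₋))A₁(b) + g(i ad_{λ′(b₋)})(Dλ′)(b) + η𝔉₁ + η𝔉₂`; `g(i ad)` is
inverted by `norm_le_of_gAd`; the remainders `η|𝔉₁| ≤ 41η|Dλ′|²`, `η|𝔉₂| ≤ 17ηa|Dλ′|` are absorbed using the a-priori `η|Dλ′| ≤ 2s`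
(`norm_eta_covDerivFwd_le`). [cite: Balaban1985RegularSpaces, p.95 (after (1.112)), (1.109) p.94, (1.84)–(1.85) p.90, (1.62) p.87] -/
theorem ineq1109_pointwise {η : ℝ} (hη : 0 < η) (U₀ : Site d → Fin d → 𝔸ˣ) {lam : Site d → 𝔸} (A₁ A₂ : Site d → Fin d → 𝔸)
    {x : Site d} (μ : Fin d) (hU : U₀ x μ ∈ U1 𝔸) {s a : ℝ} (hs : s ≤ 1 / 1000)
    (hl : ‖lam x‖ ≤ s) (hl' : ‖lam (x + e μ)‖ ≤ s)
    (hA₁ : ‖A₁ x μ‖ ≤ a) (hA₂ : ‖A₂ x μ‖ ≤ a) (hηa : η * a ≤ 1 / 170)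
    (hU₁₂ : mgauge U₀ (fun y => (gaugeExp lam y)⁻¹) (cfgExp η A₁) x μ = cfgExp η A₂ x μ) :
    ‖covDerivFwd η U₀ μ lam x‖ ≤ 5 * a := by
  set D := covDerivFwd η U₀ μ lam x with hDdef
  have hDn := norm_nonneg D
  have ha : 0 ≤ a := (norm_nonneg _).trans hA₁
  have hs0 : 0 ≤ s := (norm_nonneg _).trans hl
  -- a priori: `η‖D‖ ≤ 2s ≤ 1/500`
  have hηD : η * ‖D‖ ≤ 2 * s := (norm_eta_covDerivFwd_le hη hU lam).trans (by linarith)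
  have hηD' : η * ‖D‖ ≤ 1 / 500 := hηD.trans (by linarith)
  have hl12 : ‖lam x‖ ≤ 1 / 12 := hl.trans (hs.trans (by norm_num))
  -- (1.84) at the bond, left side `= A₂(b)`
  have h184 := eq184 hη U₀ A₁ μ hl12 (hηD'.trans (by norm_num))
  have hlhs : η⁻¹ • ((I⁻¹ : ℂ) • mlog ((mgauge U₀ (fun y => (gaugeExp lam y)⁻¹) (cfgExp η A₁) x μ : 𝔸ˣ) : 𝔸)) = A₂ x μ := by
    rw [hU₁₂, cfgExp, val_expUnit]
    have hsmall : ‖(I • (η • A₂ x μ) : 𝔸)‖ ≤ 1 / 5 := by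
      rw [norm_smul, Complex.norm_I, one_mul, norm_smul, Real.norm_eq_abs, abs_of_pos hη]
      exact (mul_le_mul_of_nonneg_left hA₂ hη.le).trans (hηa.trans (by norm_num))
    have hsmall' : ‖(I • (η • A₂ x μ) : 𝔸)‖ < Real.log 2 := hsmall.trans_lt (by linarith [Real.log_two_gt_d9])
    rw [B7BlockAvgLog.mlog_exp hsmall', smul_smul, inv_mul_cancel₀ I_ne_zero, one_smul, smul_smul, inv_mul_cancel₀ hη.ne', one_smul]
  -- isolate the `g(i ad)` term
  have hg : gAd D (lam x) = A₂ x μ - conjR (gaugeExp lam x)⁻¹ (A₁ x μ) - η • frakF1 η (lam x) D - η • frakF2 η (lam x) D (A₁ x μ) := by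
    rw [hlhs] at h184
    rw [h184]; abel
  -- bounds of the three other terms
  have h1 : ‖conjR (gaugeExp lam x)⁻¹ (A₁ x μ)‖ ≤ 6 / 5 * a := (norm_conjR_gaugeExp_inv_le hl12 _).trans (by linarith)
  have hη' : ‖(η : ℝ)‖ = η := by rw [Real.norm_eq_abs, abs_of_pos hη]
  have h2 : ‖η • frakF1 η (lam x) D‖ ≤ 41 / 500 * ‖D‖ := by
    rw [norm_smul, hη']
    have hF := norm_frakF1_le hη hl12 (D := D) (by linarith)
    calc η * ‖frakF1 η (lam x) D‖ ≤ η * (41 * ‖D‖ ^ 2) := mul_le_mul_of_nonneg_left hF hη.le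
      _ = 41 * (η * ‖D‖) * ‖D‖ := by ring
      _ ≤ 41 * (1 / 500) * ‖D‖ := mul_le_mul_of_nonneg_right (by linarith) hDn
      _ = 41 / 500 * ‖D‖ := by ring
  have h3 : ‖η • frakF2 η (lam x) D (A₁ x μ)‖ ≤ 1 / 10 * ‖D‖ := by
    rw [norm_smul, hη']
    have hA' : η * ‖A₁ x μ‖ ≤ 1 / 12 := (mul_le_mul_of_nonneg_left hA₁ hη.le).trans (hηa.trans (by norm_num))
    have hF := norm_frakF2_le hη hl12 (hηD'.trans (by norm_num)) hA'
    calc η * ‖frakF2 η (lam x) D (A₁ x μ)‖ ≤ η * (17 * ‖A₁ x μ‖ * ‖D‖) := mul_le_mul_of_nonneg_left hF hη.le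
      _ = 17 * (η * ‖A₁ x μ‖) * ‖D‖ := by ring
      _ ≤ 17 * (1 / 170) * ‖D‖ := by
          refine mul_le_mul_of_nonneg_right ?_ hDn
          exact mul_le_mul_of_nonneg_left ((mul_le_mul_of_nonneg_left hA₁ hη.le).trans hηa) (by norm_num)
      _ = 1 / 10 * ‖D‖ := by ring
  -- assemble: `‖D‖ ≤ (3/2)‖gAd D λ′‖ ≤ (3/2)(a + (6/5)a + (41/500 + 1/10)‖D‖)`
  have hgn : ‖gAd D (lam x)‖ ≤ a + 6 / 5 * a + 41 / 500 * ‖D‖ + 1 / 10 * ‖D‖ := by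
    rw [hg]
    calc ‖A₂ x μ - conjR (gaugeExp lam x)⁻¹ (A₁ x μ) - η • frakF1 η (lam x) D - η • frakF2 η (lam x) D (A₁ x μ)‖
        ≤ ‖A₂ x μ‖ + ‖conjR (gaugeExp lam x)⁻¹ (A₁ x μ)‖ + ‖η • frakF1 η (lam x) D‖ + ‖η • frakF2 η (lam x) D (A₁ x μ)‖ := by
          refine (norm_sub_le _ _).trans (add_le_add ((norm_sub_le _ _).trans (add_le_add (norm_sub_le _ _) le_rfl)) le_rfl)
      _ ≤ a + 6 / 5 * a + 41 / 500 * ‖D‖ + 1 / 10 * ‖D‖ := by gcongr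
  have hlow := norm_le_of_gAd D hl12
  nlinarith

/-- **… IN THE SCALED LETTERS OF (1.62)/(1.109)**: with `|A₁(b)|, |A₂(b)| ≤ c·(Lʲη)⁻¹` at a bond of `Ω_j` and `c·L^{−j} ≤ 1/170` (`η·(Lʲη)⁻¹ = L^{−j}`):
`|(Dλ′)(b)| ≤ 5c·(Lʲη)⁻¹`, i.e. `(Lʲη)|(Dλ′)(b)| ≤ 5c` — `λ′` lies in the `|·|₍₋₁₎`-part of the uniqueness domain (1.109) as soon as `5c < c₃`.
[cite: Balaban1985RegularSpaces, p.95 (after (1.112)), (1.109) p.94, (1.62) p.87] -/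
theorem ineq1109_scaled {η : ℝ} (hη : 0 < η) (U₀ : Site d → Fin d → 𝔸ˣ) {lam : Site d → 𝔸} (A₁ A₂ : Site d → Fin d → 𝔸)
    {x : Site d} (μ : Fin d) (hU : U₀ x μ ∈ U1 𝔸) {L j : ℕ} (hL : 1 ≤ L) {s c : ℝ} (hs : s ≤ 1 / 1000)
    (hl : ‖lam x‖ ≤ s) (hl' : ‖lam (x + e μ)‖ ≤ s)
    (hA₁ : ‖A₁ x μ‖ ≤ c * ((L : ℝ) ^ j * η)⁻¹) (hA₂ : ‖A₂ x μ‖ ≤ c * ((L : ℝ) ^ j * η)⁻¹) (hc : c * ((L : ℝ) ^ j)⁻¹ ≤ 1 / 170)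
    (hU₁₂ : mgauge U₀ (fun y => (gaugeExp lam y)⁻¹) (cfgExp η A₁) x μ = cfgExp η A₂ x μ) :
    ((L : ℝ) ^ j * η) * ‖covDerivFwd η U₀ μ lam x‖ ≤ 5 * c := by
  have hLj : (0 : ℝ) < (L : ℝ) ^ j := by
    have : (1 : ℝ) ≤ L := by exact_mod_cast hL
    positivity
  have ht : 0 < (L : ℝ) ^ j * η := by positivity
  have hηa : η * (c * ((L : ℝ) ^ j * η)⁻¹) ≤ 1 / 170 := by
    have : η * (c * ((L : ℝ) ^ j * η)⁻¹) = c * ((L : ℝ) ^ j)⁻¹ := by field_simp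
    rw [this]; exact hc
  have h := ineq1109_pointwise hη U₀ A₁ A₂ μ hU hs hl hl' hA₁ hA₂ hηa hU₁₂
  calc ((L : ℝ) ^ j * η) * ‖covDerivFwd η U₀ μ lam x‖ ≤ ((L : ℝ) ^ j * η) * (5 * (c * ((L : ℝ) ^ j * η)⁻¹)) :=
        mul_le_mul_of_nonneg_left h ht.le
    _ = 5 * c := by field_simp

/-! ## §4 From (1.73) at the fine level to `λ′` -/

omit [NormOneClass 𝔸] in
/-- **`λ′ := (1/i) log u′`**: for a unit `u′(x)` with `|u′(x) − 1| ≤ ½` ((1.73) at the fine level for `u′ = u₂u₁⁻¹`, (1.112)), the element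
`λ′(x) = i⁻¹ log u′(x)` (`log` = the series (21) of [3]) satisfies `e^{iλ′(x)} = u′(x)` (so `u′ = gaugeExp λ′` sitewise) and `|λ′(x)| ≤ 2|u′(x) − 1|` — so `u′ = e^{iλ′}` with `|λ′|`
as small as (1.73) makes `|u′ − 1|`. [cite: Balaban1985RegularSpaces, p.95 (after (1.112)), (1.109) p.94; Balaban1985Averaging, (21) p.21] -/
theorem lam_of_unit (u : 𝔸ˣ) (hu : ‖(u : 𝔸) - 1‖ ≤ 1 / 2) :
    ((expUnit (I • ((I⁻¹ : ℂ) • mlog (u : 𝔸))) : 𝔸ˣ) : 𝔸) = u ∧ ‖(I⁻¹ : ℂ) • mlog (u : 𝔸)‖ ≤ 2 * ‖(u : 𝔸) - 1‖ := by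
  refine ⟨?_, ?_⟩
  · rw [val_expUnit, smul_smul, mul_inv_cancel₀ I_ne_zero, one_smul]
    exact exp_mlog (hu.trans_lt (by norm_num))
  · rw [norm_smul, norm_inv, Complex.norm_I, inv_one, one_mul]
    exact norm_mlog_le_two_mul hu

omit [CompleteSpace 𝔸] [NormedAlgebra ℂ 𝔸] in
/-- **`|u′(x) − 1| ≤ |u₁(x) − 1| + |u₂(x) − 1|` for `u′ = u₁⁻¹u₂`** with `u₁(x)` in the unit ball `U1` (print: unitary): the fine-level input of
`lam_of_unit` from (1.72) for the two solutions (`B8Eq106Local.ineq172_local_of_axial`: `|uᵢ(x) − 1| ≤ 40d·c`). [cite: Balaban1985RegularSpaces, p.95 (after (1.112)), (1.72) p.88] -/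
theorem norm_quotient_sub_one_le {u₁ u₂ : 𝔸ˣ} (hu₁ : u₁ ∈ U1 𝔸) :
    ‖(((u₁⁻¹ * u₂ : 𝔸ˣ)) : 𝔸) - 1‖ ≤ ‖(u₁ : 𝔸) - 1‖ + ‖(u₂ : 𝔸) - 1‖ := by
  obtain ⟨-, hu'⟩ := mem_U1.mp hu₁
  have hid : (((u₁⁻¹ * u₂ : 𝔸ˣ)) : 𝔸) - 1 = ((u₁⁻¹ : 𝔸ˣ) : 𝔸) * (((u₂ : 𝔸) - 1) - ((u₁ : 𝔸) - 1)) := by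
    rw [sub_sub_sub_cancel_right, mul_sub, Units.inv_mul, Units.val_mul]
  rw [hid]
  calc ‖((u₁⁻¹ : 𝔸ˣ) : 𝔸) * (((u₂ : 𝔸) - 1) - ((u₁ : 𝔸) - 1))‖ ≤ ‖((u₁⁻¹ : 𝔸ˣ) : 𝔸)‖ * ‖((u₂ : 𝔸) - 1) - ((u₁ : 𝔸) - 1)‖ := norm_mul_le _ _
    _ ≤ 1 * (‖(u₂ : 𝔸) - 1‖ + ‖(u₁ : 𝔸) - 1‖) := by gcongr; exact norm_sub_le _ _
    _ = ‖(u₁ : 𝔸) - 1‖ + ‖(u₂ : 𝔸) - 1‖ := by ring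

/-! ## §5 The identity `U₁^{u′⁻¹} = U₂` of (1.112) in the tree's convention -/

section Identity

variable {G : Type*} [Group G]

/-- **«`U₁^{u′⁻¹} = U₂`» of (1.112)** from `U′ = U₁^{u₁} = U₂^{u₂}` ((1.17): each `uᵢ` brings its `Uᵢ` to the same axial `U′`), in the tree's
moving-frame action (55) of [3] (`B7Eq92Concrete.mgauge`; an action of the gauge group): `U₁^{(u₁⁻¹u₂)⁻¹} = U₂`, i.e. the quotient is
`u′ = u₁⁻¹u₂` in this convention (print writes `u₂u₁⁻¹` in its own).  This discharges the hypothesis of `ineq1109_pointwise` bondwise with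
`u′ = e^{iλ′}`, `(u′)⁻¹ = (y ↦ (e^{iλ′(y)})⁻¹)`. [cite: Balaban1985RegularSpaces, (1.112) p.95, (1.17) p.79; Balaban1985Averaging, (55) p.27] -/
theorem mgauge_quotient_eq (U₀ : Site d → Fin d → G) (u₁ u₂ : Site d → G) (U₁ U₂ U' : Site d → Fin d → G)
    (h₁ : mgauge U₀ u₁ U₁ = U') (h₂ : mgauge U₀ u₂ U₂ = U') : mgauge U₀ (u₁⁻¹ * u₂)⁻¹ U₁ = U₂ := by
  have hcomp : ∀ (a b : Site d → G) (W : Site d → Fin d → G), mgauge U₀ a (mgauge U₀ b W) = mgauge U₀ (a * b) W := by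
    intro a b W
    funext x κ
    simp only [mgauge_apply, Pi.mul_apply, map_mul, mul_inv_rev, mul_assoc]
  have hone : ∀ W : Site d → Fin d → G, mgauge U₀ 1 W = W := by
    intro W
    funext x κ
    simp [mgauge_apply]
  calc mgauge U₀ (u₁⁻¹ * u₂)⁻¹ U₁ = mgauge U₀ (u₂⁻¹ * u₁) U₁ := by rw [mul_inv_rev, inv_inv]
    _ = mgauge U₀ u₂⁻¹ (mgauge U₀ u₁ U₁) := (hcomp _ _ _).symm
    _ = mgauge U₀ u₂⁻¹ (mgauge U₀ u₂ U₂) := by rw [h₁, h₂]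
    _ = U₂ := by rw [hcomp, inv_mul_cancel, hone]

end Identity

end Literature.MathematicalPhysics.QuantumFieldTheory.Balaban1983to89.B8Ineq1109Local

end
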